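import Mathlib
import Summits.ValiantsHypothesis.ValiantsHypothesis.Theorems.LacunarySymmetroidMatrixDescartesOneAlternation

/-!
# `MatrixDescartes` (stmt-ValiantsHypothesis-18050) — the LOEWNER-CHAIN SECTOR, core lemmas: the Chebyshev-type
# key inequality and the Loewner-monotone family `G = F/φ_p` with its kernel data

HONEST FRAMING.  Cell `pub-symmetroid`, seat `val-sym-mdr-p2` (gen 4); helper file `--supports` the crux
`Theses.LacunarySymmetroid.MatrixDescartes`.  Technical core of the sector theorem `chainSector` (file
`…ChainSector`): nothing here bears on the crux in general, on `stub_twoSided`, on `DoorA26` / `DoorA34`, or on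
`VP ≠ VNP`.

SETTING.  `F(u) = ∑ₗ u^{dₗ} Sₗ` (`l < K`, exponents `d` strictly increasing, real symmetric `ι × ι` letters), a pivot
index `p`, the TAIL WEIGHT `φ_p(u) = ∑_{l ≥ p} u^{dₗ}` and the normalised family `G(u) = φ_p(u)⁻¹ • F(u)`.
HYPOTHESES of the sector: `Sₗ ⪯ 0` for `l < p` (head) and `Sᵢ ⪯ Sⱼ` for `p ≤ i ≤ j` (Loewner chain on the tail;
the letters themselves unconstrained).

* §1 `key_nonneg` / `key_eq_zero`: for scalars `qₗ` with `qₗ ≤ 0` (`l < p`) and `qᵢ ≤ qⱼ` (`p ≤ i ≤ j`) and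
  `0 < s ≤ t`, `φ_p(s)·f(t) − φ_p(t)·f(s) ≥ 0` where `f(u) = ∑ₗ u^{dₗ} qₗ` — the expansion is
  `∑_{l<p≤l'} w_{ll'} q_l + ½ ∑_{l,l' ≥ p} w_{ll'} (q_l − q_{l'})`, `w_{ll'} = s^{d_{l'}} t^{d_l} − t^{d_{l'}} s^{d_l}`,
  every summand `≥ 0` (a Chebyshev-sum-inequality pairing, `tail_pairing`); equality for some `s < t` forces
  `qₗ = 0` on the head and `q` constant on the tail.
* §2 `family_mono`: `G` is Loewner non-decreasing on `(0,∞)` (apply §1 to `qₗ = vᵀSₗv`); `kernelData`: at a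
  positive root `t₀` of `det F ≠ 0` there is `v ≠ 0` with `G(t₀)v = 0` and `vᵀG(s)v > 0` for all `s > t₀`
  (else §1's equality case gives `F(u)v = φ_p(u)·S_pv ≡ 0`, i.e. `det F = 0`).

[folklore] Elementary; Mathlib + tree lemma `OneAlternation.dotProduct_family_mulVec` / `family_mulVec`;
axioms `propext`, `Classical.choice`, `Quot.sound`.
-/

-- layout Summits/ValiantsHypothesis/ValiantsHypothesis forces the duplicated namespace component
set_option linter.dupNamespace false

namespace Summit.ValiantsHypothesis.ValiantsHypothesis.Theorems.LacunarySymmetroidMatrixDescartes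

open Polynomial Matrix Finset
open scoped BigOperators

namespace ChainSector

/-! ## §1 The scalar key inequality (Chebyshev-type pairing) -/

/-- Skew weights: for `0 ≤ s ≤ t` and `a ≤ b`, `s^a t^b − t^a s^b = (st)^a (t^{b−a} − s^{b−a}) ≥ 0`. [folklore] -/
theorem skew_nonneg {s t : ℝ} (hs : 0 ≤ s) (hst : s ≤ t) {a b : ℕ} (hab : a ≤ b) :
    0 ≤ s ^ a * t ^ b - t ^ a * s ^ b := by
  obtain ⟨c, rfl⟩ := Nat.exists_eq_add_of_le hab
  have e : s ^ a * t ^ (a + c) - t ^ a * s ^ (a + c) = s ^ a * t ^ a * (t ^ c - s ^ c) := by ring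
  rw [e]
  exact mul_nonneg (mul_nonneg (pow_nonneg hs _) (pow_nonneg (hs.trans hst) _))
    (sub_nonneg.2 (pow_le_pow_left₀ hs hst _))

/-- Strict skew weights: for `0 < s < t` and `a < b`, `s^a t^b − t^a s^b > 0`. [folklore] -/
theorem skew_pos {s t : ℝ} (hs : 0 < s) (hst : s < t) {a b : ℕ} (hab : a < b) :
    0 < s ^ a * t ^ b - t ^ a * s ^ b := by
  obtain ⟨c, rfl⟩ := Nat.exists_eq_add_of_le hab.le
  have hc : c ≠ 0 := by omega
  have e : s ^ a * t ^ (a + c) - t ^ a * s ^ (a + c) = s ^ a * t ^ a * (t ^ c - s ^ c) := by ring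
  rw [e]
  exact mul_pos (mul_pos (pow_pos hs _) (pow_pos (hs.trans hst) _))
    (sub_pos.2 (pow_lt_pow_left₀ hst hs.le hc))

variable {K : ℕ}

/-- Expansion of the skew form: `φ(s)·f(t) − φ(t)·f(s) = ∑_{l' ∈ P} ∑ₗ (s^{d l'} t^{d l} − t^{d l'} s^{d l})·qₗ`
for `f(u) = ∑ₗ u^{dₗ} qₗ` and `φ(u) = ∑_{l' ∈ P} u^{d l'}`. [folklore] -/
theorem skewForm_expand (d : Fin K → ℕ) (q : Fin K → ℝ) (P : Finset (Fin K)) (s t : ℝ) :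
    (∑ l' ∈ P, s ^ d l') * (∑ l, t ^ d l * q l) - (∑ l' ∈ P, t ^ d l') * (∑ l, s ^ d l * q l)
      = ∑ l' ∈ P, ∑ l, (s ^ d l' * t ^ d l - t ^ d l' * s ^ d l) * q l := by
  rw [Finset.sum_mul_sum, Finset.sum_mul_sum, ← Finset.sum_sub_distrib]
  refine Finset.sum_congr rfl fun l' _ => ?_
  rw [← Finset.sum_sub_distrib]
  refine Finset.sum_congr rfl fun l _ => ?_
  ring

/-- Pairing identity on the tail block: twice `∑_{a,b ∈ P} w(b,a)·q_b` equals `∑_{a,b ∈ P} w(b,a)·(q_b − q_a)`, by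
the antisymmetry `w(a,b) = −w(b,a)` of the skew weights. [folklore] -/
theorem tail_pairing (d : Fin K → ℕ) (q : Fin K → ℝ) (P : Finset (Fin K)) (s t : ℝ) :
    2 * (∑ a ∈ P, ∑ b ∈ P, (s ^ d a * t ^ d b - t ^ d a * s ^ d b) * q b)
      = ∑ a ∈ P, ∑ b ∈ P, (s ^ d a * t ^ d b - t ^ d a * s ^ d b) * (q b - q a) := by
  rw [two_mul]
  nth_rewrite 2 [Finset.sum_comm]
  rw [← Finset.sum_add_distrib]
  refine Finset.sum_congr rfl fun a _ => ?_
  rw [← Finset.sum_add_distrib]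
  refine Finset.sum_congr rfl fun b _ => ?_
  ring

/-- **Key inequality.**  Exponents `d` strictly increasing, pivot index `p`, scalars `qₗ ≤ 0` for `l < p` and
`qᵢ ≤ qⱼ` for `p ≤ i ≤ j`.  Then for `0 < s ≤ t`, with `φ(u) = ∑_{l ≥ p} u^{dₗ}` and `f(u) = ∑ₗ u^{dₗ} qₗ`,
`φ(s) f(t) − φ(t) f(s) ≥ 0` — i.e. `f/φ` is non-decreasing on `(0,∞)`. [folklore] -/
theorem key_nonneg (d : Fin K → ℕ) (hd : StrictMono d) (p : Fin K) (q : Fin K → ℝ)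
    (hhead : ∀ l, l < p → q l ≤ 0) (htail : ∀ i j, p ≤ i → i ≤ j → q i ≤ q j)
    {s t : ℝ} (hs : 0 < s) (hst : s ≤ t) :
    0 ≤ (∑ l' ∈ univ.filter (fun l' => p ≤ l'), s ^ d l') * (∑ l, t ^ d l * q l)
        - (∑ l' ∈ univ.filter (fun l' => p ≤ l'), t ^ d l') * (∑ l, s ^ d l * q l) := by
  set P := univ.filter (fun l' : Fin K => p ≤ l') with hP
  rw [skewForm_expand]
  -- split the inner sum into head (`l < p`) and tail (`p ≤ l`)
  have hsplit : ∀ l' : Fin K, ∑ l, (s ^ d l' * t ^ d l - t ^ d l' * s ^ d l) * q l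
      = ∑ l ∈ P, (s ^ d l' * t ^ d l - t ^ d l' * s ^ d l) * q l
        + ∑ l ∈ univ.filter (fun l => ¬ p ≤ l), (s ^ d l' * t ^ d l - t ^ d l' * s ^ d l) * q l :=
    fun l' => (Finset.sum_filter_add_sum_filter_not _ _ _).symm
  simp_rw [hsplit]
  rw [Finset.sum_add_distrib]
  refine add_nonneg ?_ ?_
  · -- tail block: pairing
    have h2 := tail_pairing d q P s t
    have hnn : 0 ≤ ∑ a ∈ P, ∑ b ∈ P, (s ^ d a * t ^ d b - t ^ d a * s ^ d b) * (q b - q a) := by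
      refine Finset.sum_nonneg fun a ha => Finset.sum_nonneg fun b hb => ?_
      have hpa : p ≤ a := (Finset.mem_filter.1 ha).2
      have hpb : p ≤ b := (Finset.mem_filter.1 hb).2
      rcases le_total a b with hab | hba
      · exact mul_nonneg (skew_nonneg hs.le hst (hd.monotone hab)) (sub_nonneg.2 (htail a b hpa hab))
      · have hw : s ^ d a * t ^ d b - t ^ d a * s ^ d b ≤ 0 := by
          have := skew_nonneg hs.le hst (hd.monotone hba)
          linarith
        exact mul_nonneg_of_nonpos_of_nonpos hw (sub_nonpos.2 (htail b a hpb hba))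
    linarith
  · -- head block: termwise
    refine Finset.sum_nonneg fun l' hl' => Finset.sum_nonneg fun l hl => ?_
    have hpl' : p ≤ l' := (Finset.mem_filter.1 hl').2
    have hlp : l < p := not_le.1 (Finset.mem_filter.1 hl).2
    have hw : s ^ d l' * t ^ d l - t ^ d l' * s ^ d l ≤ 0 := by
      have := skew_nonneg hs.le hst (hd.monotone (hlp.le.trans hpl'))
      linarith
    exact mul_nonneg_of_nonpos_of_nonpos hw (hhead l hlp)

/-- **Key inequality, equality case.**  Under the hypotheses of `key_nonneg`, if `0 < s < t` and
`φ(s) f(t) − φ(t) f(s) = 0`, then `qₗ = 0` for every `l < p` and `q` is constant on the tail: `qⱼ = q_p` for every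
`j ≥ p`. [folklore] -/
theorem key_eq_zero (d : Fin K → ℕ) (hd : StrictMono d) (p : Fin K) (q : Fin K → ℝ)
    (hhead : ∀ l, l < p → q l ≤ 0) (htail : ∀ i j, p ≤ i → i ≤ j → q i ≤ q j)
    {s t : ℝ} (hs : 0 < s) (hst : s < t)
    (hzero : (∑ l' ∈ univ.filter (fun l' => p ≤ l'), s ^ d l') * (∑ l, t ^ d l * q l)
        - (∑ l' ∈ univ.filter (fun l' => p ≤ l'), t ^ d l') * (∑ l, s ^ d l * q l) = 0) :
    (∀ l, l < p → q l = 0) ∧ (∀ j, p ≤ j → q j = q p) := by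
  set P := univ.filter (fun l' : Fin K => p ≤ l') with hP
  have hpP : p ∈ P := Finset.mem_filter.2 ⟨Finset.mem_univ _, le_rfl⟩
  rw [skewForm_expand] at hzero
  have hsplit : ∀ l' : Fin K, ∑ l, (s ^ d l' * t ^ d l - t ^ d l' * s ^ d l) * q l
      = ∑ l ∈ P, (s ^ d l' * t ^ d l - t ^ d l' * s ^ d l) * q l
        + ∑ l ∈ univ.filter (fun l => ¬ p ≤ l), (s ^ d l' * t ^ d l - t ^ d l' * s ^ d l) * q l :=
    fun l' => (Finset.sum_filter_add_sum_filter_not _ _ _).symm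
  simp_rw [hsplit] at hzero
  rw [Finset.sum_add_distrib] at hzero
  -- both blocks are nonnegative, hence both vanish
  have htailnn : ∀ a ∈ P, ∀ b ∈ P, 0 ≤ (s ^ d a * t ^ d b - t ^ d a * s ^ d b) * (q b - q a) := by
    intro a ha b hb
    have hpa : p ≤ a := (Finset.mem_filter.1 ha).2
    have hpb : p ≤ b := (Finset.mem_filter.1 hb).2
    rcases le_total a b with hab | hba
    · exact mul_nonneg (skew_nonneg hs.le hst.le (hd.monotone hab)) (sub_nonneg.2 (htail a b hpa hab))
    · have hw : s ^ d a * t ^ d b - t ^ d a * s ^ d b ≤ 0 := by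
        have := skew_nonneg hs.le hst.le (hd.monotone hba)
        linarith
      exact mul_nonneg_of_nonpos_of_nonpos hw (sub_nonpos.2 (htail b a hpb hba))
  have hheadnn : ∀ l' ∈ P, ∀ l ∈ univ.filter (fun l : Fin K => ¬ p ≤ l),
      0 ≤ (s ^ d l' * t ^ d l - t ^ d l' * s ^ d l) * q l := by
    intro l' hl' l hl
    have hpl' : p ≤ l' := (Finset.mem_filter.1 hl').2
    have hlp : l < p := not_le.1 (Finset.mem_filter.1 hl).2
    have hw : s ^ d l' * t ^ d l - t ^ d l' * s ^ d l ≤ 0 := by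
      have := skew_nonneg hs.le hst.le (hd.monotone (hlp.le.trans hpl'))
      linarith
    exact mul_nonneg_of_nonpos_of_nonpos hw (hhead l hlp)
  have hB : 0 ≤ ∑ a ∈ P, ∑ b ∈ P, (s ^ d a * t ^ d b - t ^ d a * s ^ d b) * q b := by
    have h2 := tail_pairing d q P s t
    have := Finset.sum_nonneg fun a ha => Finset.sum_nonneg fun b hb => htailnn a ha b hb
    linarith
  have hA : 0 ≤ ∑ l' ∈ P, ∑ l ∈ univ.filter (fun l : Fin K => ¬ p ≤ l),
      (s ^ d l' * t ^ d l - t ^ d l' * s ^ d l) * q l :=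
    Finset.sum_nonneg fun l' hl' => Finset.sum_nonneg fun l hl => hheadnn l' hl' l hl
  have hA0 : ∑ l' ∈ P, ∑ l ∈ univ.filter (fun l : Fin K => ¬ p ≤ l),
      (s ^ d l' * t ^ d l - t ^ d l' * s ^ d l) * q l = 0 := by linarith
  have hB0 : ∑ a ∈ P, ∑ b ∈ P, (s ^ d a * t ^ d b - t ^ d a * s ^ d b) * (q b - q a) = 0 := by
    rw [← tail_pairing]; linarith
  refine ⟨fun l hlp => ?_, fun j hpj => ?_⟩
  · -- head: the term `(l' = p, l)` vanishes and its weight is `< 0`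
    have h1 := (Finset.sum_eq_zero_iff_of_nonneg fun l' hl' =>
      Finset.sum_nonneg fun l hl => hheadnn l' hl' l hl).1 hA0 p hpP
    have hlmem : l ∈ univ.filter (fun l : Fin K => ¬ p ≤ l) :=
      Finset.mem_filter.2 ⟨Finset.mem_univ _, not_le.2 hlp⟩
    have h2 := (Finset.sum_eq_zero_iff_of_nonneg fun l hl => hheadnn p hpP l hl).1 h1 l hlmem
    have hw : s ^ d p * t ^ d l - t ^ d p * s ^ d l < 0 := by
      have := skew_pos hs hst (hd hlp)
      linarith
    exact (mul_eq_zero.1 h2).resolve_left hw.ne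
  · -- tail: the term `(a = p, b = j)` vanishes and its weight is `> 0` unless `j = p`
    rcases hpj.lt_or_eq with hlt | heq
    · have hjP : j ∈ P := Finset.mem_filter.2 ⟨Finset.mem_univ _, hpj⟩
      have h1 := (Finset.sum_eq_zero_iff_of_nonneg fun a ha =>
        Finset.sum_nonneg fun b hb => htailnn a ha b hb).1 hB0 p hpP
      have h2 := (Finset.sum_eq_zero_iff_of_nonneg fun b hb => htailnn p hpP b hb).1 h1 j hjP
      have hw : 0 < s ^ d p * t ^ d j - t ^ d p * s ^ d j := skew_pos hs hst (hd hlt)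
      have h3 := (mul_eq_zero.1 h2).resolve_left hw.ne'
      linarith
    · rw [heq]

/-! ## §2 The Loewner-monotone family `G = F/φ_p` and its kernel data -/

variable {ι : Type*} [Fintype ι]

/-- The tail weight `φ_p(u) = ∑_{l ≥ p} u^{dₗ}` is positive for `u > 0` (the pivot term alone is positive).
[folklore] -/
theorem tailWeight_pos (d : Fin K → ℕ) (p : Fin K) {u : ℝ} (hu : 0 < u) :
    0 < ∑ l' ∈ univ.filter (fun l' => p ≤ l'), u ^ d l' := by
  have hpP : p ∈ univ.filter (fun l' : Fin K => p ≤ l') :=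
    Finset.mem_filter.2 ⟨Finset.mem_univ _, le_rfl⟩
  exact lt_of_lt_of_le (pow_pos hu _)
    (Finset.single_le_sum (f := fun l' => u ^ d l') (fun l' _ => (pow_pos hu _).le) hpP)

/-- Entrywise evaluation of the pencil at a real point: `(∑ₗ X^{dₗ}•Sₗ)(s) = ∑ₗ s^{dₗ}•Sₗ`. [folklore] -/
theorem evalRingHom_mapMatrix_pencil [DecidableEq ι] (d : Fin K → ℕ) (S : Fin K → Matrix ι ι ℝ) (s : ℝ) :
    (Polynomial.evalRingHom s).mapMatrix
        (∑ l, ((Polynomial.X : Polynomial ℝ) ^ d l) • (S l).map Polynomial.C)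
      = ∑ l, (s ^ d l) • S l := by
  ext i j
  simp only [RingHom.mapMatrix_apply, Matrix.map_apply, Matrix.smul_apply, Matrix.sum_apply,
    smul_eq_mul, Polynomial.coe_evalRingHom, Polynomial.eval_mul, Polynomial.eval_pow,
    Polynomial.eval_X, Polynomial.eval_C, Polynomial.eval_finsetSum]

/-- Evaluating the determinant: `(det ∑ₗ X^{dₗ} Sₗ)(s) = det (∑ₗ s^{dₗ} Sₗ)`. [folklore] -/
theorem eval_det_pencil [DecidableEq ι] (d : Fin K → ℕ) (S : Fin K → Matrix ι ι ℝ) (s : ℝ) :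
    (Matrix.det (∑ l, ((Polynomial.X : Polynomial ℝ) ^ d l) • (S l).map Polynomial.C)).eval s
      = (∑ l, (s ^ d l) • S l).det := by
  have h := RingHom.map_det (Polynomial.evalRingHom s)
    (∑ l, ((Polynomial.X : Polynomial ℝ) ^ d l) • (S l).map Polynomial.C)
  rw [Polynomial.coe_evalRingHom] at h
  rw [h, evalRingHom_mapMatrix_pencil d S s]

/-- The quadratic form of the normalised family `G(u) = φ_p(u)⁻¹ • ∑ₗ u^{dₗ} Sₗ` at `v` is
`φ_p(u)⁻¹ · ∑ₗ u^{dₗ}·(vᵀSₗv)`. [folklore] -/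
theorem quadForm_family (d : Fin K → ℕ) (S : Fin K → Matrix ι ι ℝ) (p : Fin K) (u : ℝ) (v : ι → ℝ) :
    v ⬝ᵥ (((∑ l' ∈ univ.filter (fun l' => p ≤ l'), u ^ d l')⁻¹ • ∑ l, (u ^ d l) • S l) *ᵥ v)
      = (∑ l' ∈ univ.filter (fun l' => p ≤ l'), u ^ d l')⁻¹ * ∑ l, u ^ d l * (v ⬝ᵥ (S l *ᵥ v)) := by
  rw [Matrix.smul_mulVec, dotProduct_smul, smul_eq_mul, OneAlternation.dotProduct_family_mulVec]

omit [Fintype ι] in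
/-- The normalised family is symmetric when the letters are. [folklore] -/
theorem family_isSymm (d : Fin K → ℕ) (S : Fin K → Matrix ι ι ℝ) (hS : ∀ l, (S l).IsSymm) (p : Fin K)
    (u : ℝ) : (((∑ l' ∈ univ.filter (fun l' => p ≤ l'), u ^ d l')⁻¹ • ∑ l, (u ^ d l) • S l)).IsSymm := by
  have hsum : (∑ l, (u ^ d l) • S l).IsSymm := by
    unfold Matrix.IsSymm
    rw [Matrix.transpose_sum]
    exact Finset.sum_congr rfl fun l _ => by rw [Matrix.transpose_smul, (hS l).eq]
  exact hsum.smul _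

/-- **Loewner monotonicity.**  Under the chain-sector hypotheses (exponents increasing; `Sₗ ⪯ 0` for `l < p`;
`Sᵢ ⪯ Sⱼ` for `p ≤ i ≤ j`) the normalised family `G(u) = φ_p(u)⁻¹ • F(u)` is Loewner non-decreasing on `u > 0`.
[folklore] -/
theorem family_mono (d : Fin K → ℕ) (hd : StrictMono d) (S : Fin K → Matrix ι ι ℝ) (hS : ∀ l, (S l).IsSymm)
    (p : Fin K) (hhead : ∀ l, l < p → (-S l).PosSemidef)
    (htail : ∀ i j, p ≤ i → i ≤ j → (S j - S i).PosSemidef) (s t : ℝ) (hs : 0 < s) (hst : s ≤ t) :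
    ((((∑ l' ∈ univ.filter (fun l' => p ≤ l'), t ^ d l')⁻¹ • ∑ l, (t ^ d l) • S l))
      - (((∑ l' ∈ univ.filter (fun l' => p ≤ l'), s ^ d l')⁻¹ • ∑ l, (s ^ d l) • S l))).PosSemidef := by
  refine Matrix.PosSemidef.of_dotProduct_mulVec_nonneg ?_ fun v => ?_
  · have h : ((((∑ l' ∈ univ.filter (fun l' => p ≤ l'), t ^ d l')⁻¹ • ∑ l, (t ^ d l) • S l))
        - (((∑ l' ∈ univ.filter (fun l' => p ≤ l'), s ^ d l')⁻¹ • ∑ l, (s ^ d l) • S l))).IsSymm := by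
      unfold Matrix.IsSymm
      rw [Matrix.transpose_sub, (family_isSymm d S hS p t).eq, (family_isSymm d S hS p s).eq]
    exact Matrix.isHermitian_iff_isSymm.2 h
  · rw [star_trivial, Matrix.sub_mulVec, dotProduct_sub, quadForm_family, quadForm_family, sub_nonneg]
    -- the scalar hypotheses on `qₗ = vᵀSₗv`
    set q : Fin K → ℝ := fun l => v ⬝ᵥ (S l *ᵥ v) with hq
    have hheadq : ∀ l, l < p → q l ≤ 0 := by
      intro l hl
      have h := (hhead l hl).dotProduct_mulVec_nonneg v
      rw [star_trivial, Matrix.neg_mulVec, dotProduct_neg] at h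
      simp only [hq]
      linarith
    have htailq : ∀ i j, p ≤ i → i ≤ j → q i ≤ q j := by
      intro i j hpi hij
      have h := (htail i j hpi hij).dotProduct_mulVec_nonneg v
      rw [star_trivial, Matrix.sub_mulVec, dotProduct_sub] at h
      simp only [hq]
      linarith
    have hkey := key_nonneg d hd p q hheadq htailq hs hst
    have hφs := tailWeight_pos d p hs
    have hφt := tailWeight_pos d p (hs.trans_le hst)
    have e1 : ∑ l, t ^ d l * q l = ∑ l, t ^ d l * (v ⬝ᵥ (S l *ᵥ v)) := rfl
    have e2 : ∑ l, s ^ d l * q l = ∑ l, s ^ d l * (v ⬝ᵥ (S l *ᵥ v)) := rfl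
    rw [← e1, ← e2, inv_mul_eq_div, inv_mul_eq_div, div_le_div_iff₀ hφs hφt]
    linarith

/-- **Kernel data at a positive root.**  Under the chain-sector hypotheses, if `det F ≠ 0` and `t₀ > 0` is a root
of `det F`, there is `v ≠ 0` with `G(t₀)v = 0` and `vᵀG(s)v > 0` for every `s > t₀`; for if the form vanished at
some `s > t₀`, the equality case of the key inequality would give `Sₗv = 0` on the head and `Sₗv = S_pv` on the
tail, so `F(u)v = φ_p(u)·S_pv` for all `u`, and `F(t₀)v = 0` would force `S_pv = 0`, i.e. `det F ≡ 0`.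
[folklore] -/
theorem kernelData [DecidableEq ι] (d : Fin K → ℕ) (hd : StrictMono d) (S : Fin K → Matrix ι ι ℝ)
    (p : Fin K) (hhead : ∀ l, l < p → (-S l).PosSemidef)
    (htail : ∀ i j, p ≤ i → i ≤ j → (S j - S i).PosSemidef)
    (hdet : Matrix.det (∑ l, ((Polynomial.X : Polynomial ℝ) ^ d l) • (S l).map Polynomial.C) ≠ 0)
    (t₀ : ℝ) (ht₀ : 0 < t₀)
    (hroot : (Matrix.det (∑ l, ((Polynomial.X : Polynomial ℝ) ^ d l) •
      (S l).map Polynomial.C)).IsRoot t₀) :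
    ∃ v : ι → ℝ, v ≠ 0 ∧
      ((∑ l' ∈ univ.filter (fun l' => p ≤ l'), t₀ ^ d l')⁻¹ • ∑ l, (t₀ ^ d l) • S l) *ᵥ v = 0 ∧
      ∀ s : ℝ, t₀ < s →
        0 < v ⬝ᵥ (((∑ l' ∈ univ.filter (fun l' => p ≤ l'), s ^ d l')⁻¹ • ∑ l, (s ^ d l) • S l) *ᵥ v) := by
  -- Step 1: `det F(t₀) = 0`, a nonzero kernel vector of `F(t₀)` (hence of `G(t₀)`)
  have hdet0 : (∑ l, (t₀ ^ d l) • S l).det = 0 := by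
    have h1 : (Matrix.det (∑ l, ((Polynomial.X : Polynomial ℝ) ^ d l) •
        (S l).map Polynomial.C)).eval t₀ = 0 := hroot
    rwa [eval_det_pencil d S t₀] at h1
  obtain ⟨v, hv, hFv⟩ := Matrix.exists_mulVec_eq_zero_iff.2 hdet0
  have hGv : ((∑ l' ∈ univ.filter (fun l' => p ≤ l'), t₀ ^ d l')⁻¹ • ∑ l, (t₀ ^ d l) • S l) *ᵥ v = 0 := by
    rw [Matrix.smul_mulVec, hFv, smul_zero]
  refine ⟨v, hv, hGv, fun s hs => ?_⟩
  -- the scalar data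
  set q : Fin K → ℝ := fun l => v ⬝ᵥ (S l *ᵥ v) with hq
  have hheadq : ∀ l, l < p → q l ≤ 0 := by
    intro l hl
    have h := (hhead l hl).dotProduct_mulVec_nonneg v
    rw [star_trivial, Matrix.neg_mulVec, dotProduct_neg] at h
    simp only [hq]
    linarith
  have htailq : ∀ i j, p ≤ i → i ≤ j → q i ≤ q j := by
    intro i j hpi hij
    have h := (htail i j hpi hij).dotProduct_mulVec_nonneg v
    rw [star_trivial, Matrix.sub_mulVec, dotProduct_sub] at h
    simp only [hq]
    linarith
  have hs0 : 0 < s := ht₀.trans hs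
  have hφs := tailWeight_pos d p hs0
  have hφt := tailWeight_pos d p ht₀
  -- `f(t₀) = vᵀF(t₀)v = 0`
  have hft₀ : ∑ l, t₀ ^ d l * q l = 0 := by
    have h : v ⬝ᵥ ((∑ l, (t₀ ^ d l) • S l) *ᵥ v) = 0 := by rw [hFv, dotProduct_zero]
    rwa [OneAlternation.dotProduct_family_mulVec] at h
  -- the form at `s` is `φ(s)⁻¹ f(s)` with `φ(t₀) f(s) = φ(t₀) f(s) − φ(s) f(t₀) ≥ 0`
  have hkey := key_nonneg d hd p q hheadq htailq ht₀ hs.le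
  rw [hft₀, mul_zero, sub_zero] at hkey
  have hfs : 0 ≤ ∑ l, s ^ d l * q l := nonneg_of_mul_nonneg_right hkey hφt
  rw [quadForm_family]
  refine (mul_nonneg (inv_pos.2 hφs).le hfs).lt_of_ne fun hzero => ?_
  -- Step 2: if the form vanishes at `s`, the equality case of the key inequality applies
  have hfs0 : ∑ l, s ^ d l * q l = 0 := by
    rcases mul_eq_zero.1 hzero.symm with h | h
    · exact absurd h (inv_pos.2 hφs).ne'
    · exact h
  have hE : (∑ l' ∈ univ.filter (fun l' => p ≤ l'), t₀ ^ d l') * (∑ l, s ^ d l * q l)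
      - (∑ l' ∈ univ.filter (fun l' => p ≤ l'), s ^ d l') * (∑ l, t₀ ^ d l * q l) = 0 := by
    rw [hfs0, hft₀, mul_zero, mul_zero, sub_zero]
  obtain ⟨hq0, hqc⟩ := key_eq_zero d hd p q hheadq htailq ht₀ hs hE
  -- ... so `Sₗ v = 0` on the head and `Sₗ v = S_p v` on the tail
  have hSv_tail : ∀ l, p ≤ l → S l *ᵥ v = S p *ᵥ v := by
    intro l hpl
    have h := (htail p l le_rfl hpl).dotProduct_mulVec_zero_iff v
    rw [star_trivial, Matrix.sub_mulVec, dotProduct_sub] at h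
    have h2 : v ⬝ᵥ (S l *ᵥ v) - v ⬝ᵥ (S p *ᵥ v) = 0 := by
      have := hqc l hpl
      simp only [hq] at this
      linarith
    exact sub_eq_zero.1 (h.1 h2)
  have hSv_head : ∀ l, l < p → S l *ᵥ v = 0 := by
    intro l hlp
    have h := (hhead l hlp).dotProduct_mulVec_zero_iff v
    rw [star_trivial, Matrix.neg_mulVec, dotProduct_neg, neg_eq_zero] at h
    have h2 : v ⬝ᵥ (S l *ᵥ v) = 0 := by
      have := hq0 l hlp
      simpa only [hq] using this
    have h3 := h.1 h2
    rwa [neg_eq_zero] at h3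
  -- ... hence `F(u) v = φ_p(u) • S_p v` for every real `u`
  have hFu : ∀ u : ℝ, (∑ l, (u ^ d l) • S l) *ᵥ v
      = (∑ l' ∈ univ.filter (fun l' => p ≤ l'), u ^ d l') • (S p *ᵥ v) := by
    intro u
    rw [OneAlternation.family_mulVec, Finset.sum_smul,
      ← Finset.sum_filter_add_sum_filter_not univ (fun l : Fin K => p ≤ l)]
    have hz : ∑ l ∈ univ.filter (fun l : Fin K => ¬ p ≤ l), u ^ d l • (S l *ᵥ v) = 0 :=
      Finset.sum_eq_zero fun l hl => by
        rw [hSv_head l (not_le.1 (Finset.mem_filter.1 hl).2), smul_zero]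
    rw [hz, add_zero]
    exact Finset.sum_congr rfl fun l hl => by rw [hSv_tail l (Finset.mem_filter.1 hl).2]
  -- at `u = t₀` this forces `S_p v = 0`
  have hSpv : S p *ᵥ v = 0 := by
    have h := hFu t₀
    rw [hFv] at h
    exact (smul_eq_zero.1 h.symm).resolve_left hφt.ne'
  -- ... so `det F(u) = 0` for every `u`, and `det F = 0`: contradiction
  have hdet' : ∀ u : ℝ, (∑ l, (u ^ d l) • S l).det = 0 := fun u =>
    Matrix.exists_mulVec_eq_zero_iff.1 ⟨v, hv, by rw [hFu u, hSpv, smul_zero]⟩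
  refine hdet (Polynomial.eq_zero_of_infinite_isRoot _ ((Set.Ioi_infinite (0 : ℝ)).mono ?_))
  intro u _
  show (Matrix.det (∑ l, ((Polynomial.X : Polynomial ℝ) ^ d l) •
      (S l).map Polynomial.C)).IsRoot u
  rw [Polynomial.IsRoot, eval_det_pencil d S u, hdet' u]

end ChainSector

end Summit.ValiantsHypothesis.ValiantsHypothesis.Theorems.LacunarySymmetroidMatrixDescartes
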